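import Mathlib
import Literature.MathematicalPhysics.StatisticalMechanics.Crystallization
import Literature.MathematicalPhysics.StatisticalMechanics.LennardJonesClusters
import Literature.MathematicalPhysics.StatisticalMechanics.LocalMatchingCompactness
import Summits.AtomisticToContinuum.Crystallization.Theorems.BraggSlacknessRigiditySlacknessTransferFourier
import Summits.AtomisticToContinuum.Crystallization.Theorems.BraggSlacknessRigidityHcpDiffractionRigidityDenseCentresAux
import Summits.AtomisticToContinuum.Crystallization.Theorems.BraggSlacknessRigidityHcpDiffractionRigidityDenseCentresAux2

/-!
# An operator inequality for Gaussian windows (quiet-centres stub of `HcpDiffractionRigidity`,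
# item `stmt-AtomisticToContinuum-13166`, stub `stub_quietCentres`, Aux file 1)

For a finite `δ`-separated configuration `y` in `ℝ³` and the Gaussian matrix
`M_ij = e^{-|y_j - y_i|²/L²}` (`L ≥ 1`), the sum over all particle centres `i` of the squared
Gaussian-windowed structure factors is controlled by ONE Gaussian pair sum:

`∑ᵢ |∑ⱼ M_ij e^{2πi⟨ξ, y_j - y_i⟩}|² ≤ Λ · Re ∑ⱼ∑ₖ M_jk e^{2πi⟨ξ,y_j⟩} conj e^{2πi⟨ξ,y_k⟩}`,
`Λ = 2(2/δ+1)³ π√π L³` (`sum_normSq_window_le`).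

This is `M² ≤ ‖M‖ M` for the positive semidefinite matrix `M`:
* `sum_normSq_mulVec_le` — for a real symmetric `M` whose sesquilinear form `B` is positive
  semidefinite on `ℂᴺ` and bounded by `Λ`, `‖Mv‖² ≤ Λ Re B(v,v)` (from the identity
  `Λ(Λ B(v,v) - ‖Mv‖²) = B(Λv - Mv, Λv - Mv) + (Λ‖Mv‖² - B(Mv,Mv))`);
* `re_qf_le` — the Schur bound `Re B(u,u) ≤ (max row sum) ‖u‖²` for nonnegative entries;
* `re_qf_gauss_nonneg` — positive semidefiniteness of the Gaussian matrix on `ℂᴺ` (the Gaussian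
  is a convolution square: `integral_gauss_mul_gauss`);
* `rowsum_gauss_le` — row sums `≤ 2(2/δ+1)³ π√π L³` (`sum_exp_le`).

All `[folklore]`.
-/

noncomputable section

namespace Summit.AtomisticToContinuum.Crystallization.Theorems

namespace HcpRigidityQuietCentres

open MeasureTheory Complex Metric Set
open scoped BigOperators Real RealInnerProductSpace ComplexConjugate
open Literature.MathematicalPhysics.StatisticalMechanics
open Summit.AtomisticToContinuum.Crystallization.Theorems.BraggSlacknessTransfer
open Summit.AtomisticToContinuum.Crystallization.Theorems.HcpRigidityDenseCentres

/-! ## The operator inequality `M² ≤ Λ M` -/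

/-- **`M² ≤ Λ M`.** For a real symmetric matrix `M` whose sesquilinear form
`B(u, w) = ∑ⱼ∑ₖ M_jk uⱼ conj(wₖ)` is positive semidefinite on `ℂᴺ` and bounded by `Λ > 0`,
`∑ᵢ |(Mv)ᵢ|² ≤ Λ Re B(v, v)` (from the identity
`Λ(Λ B(v,v) - ‖Mv‖²) = B(Λv - Mv, Λv - Mv) + (Λ‖Mv‖² - B(Mv,Mv))`). [folklore] -/
theorem sum_normSq_mulVec_le {N : ℕ} (M : Fin N → Fin N → ℝ) (hsymm : ∀ i j, M i j = M j i)
    (hpsd : ∀ u : Fin N → ℂ, 0 ≤ (∑ j, ∑ k, (M j k : ℂ) * u j * conj (u k)).re) {Λ : ℝ}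
    (hΛ : 0 < Λ)
    (hbd : ∀ u : Fin N → ℂ, (∑ j, ∑ k, (M j k : ℂ) * u j * conj (u k)).re ≤ Λ * ∑ j, ‖u j‖ ^ 2)
    (v : Fin N → ℂ) :
    ∑ i, ‖∑ j, (M i j : ℂ) * v j‖ ^ 2 ≤ Λ * (∑ j, ∑ k, (M j k : ℂ) * v j * conj (v k)).re := by
  -- the sesquilinear form and its (sesqui)linearity
  set B : (Fin N → ℂ) → (Fin N → ℂ) → ℂ := fun u w => ∑ j, ∑ k, (M j k : ℂ) * u j * conj (w k)
    with hB
  have hsubl : ∀ u u' w, B (u - u') w = B u w - B u' w := fun u u' w => by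
    simp only [hB, Pi.sub_apply, mul_sub, sub_mul, Finset.sum_sub_distrib]
  have hsubr : ∀ u w w', B u (w - w') = B u w - B u w' := fun u w w' => by
    simp only [hB, Pi.sub_apply, map_sub, mul_sub, Finset.sum_sub_distrib]
  have hsmull : ∀ (c : ℂ) (u w), B (c • u) w = c * B u w := fun c u w => by
    simp only [hB, Pi.smul_apply, smul_eq_mul, Finset.mul_sum]
    exact Finset.sum_congr rfl fun j _ => Finset.sum_congr rfl fun k _ => by ring
  have hsmulr : ∀ (c : ℝ) (u w), B u ((c : ℂ) • w) = c * B u w := fun c u w => by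
    simp only [hB, Pi.smul_apply, smul_eq_mul, Finset.mul_sum, map_mul, Complex.conj_ofReal]
    exact Finset.sum_congr rfl fun j _ => Finset.sum_congr rfl fun k _ => by ring
  set a : Fin N → ℂ := fun i => ∑ j, (M i j : ℂ) * v j with ha
  set A : ℝ := ∑ i, ‖∑ j, (M i j : ℂ) * v j‖ ^ 2 with hA
  -- `B(v, Mv) = B(Mv, v) = ‖Mv‖²`
  have hva : B v a = (A : ℂ) := by
    simp only [hB, hA, ha]
    rw [Finset.sum_comm]
    push_cast
    refine Finset.sum_congr rfl fun k _ => ?_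
    rw [← Complex.mul_conj']
    rw [Finset.sum_mul]
    refine Finset.sum_congr rfl fun j _ => ?_
    rw [hsymm j k]
  have hav : B a v = (A : ℂ) := by
    simp only [hB, hA, ha]
    push_cast
    refine Finset.sum_congr rfl fun j _ => ?_
    rw [← Complex.mul_conj', map_sum, Finset.mul_sum]
    refine Finset.sum_congr rfl fun k _ => ?_
    simp only [map_mul, Complex.conj_ofReal]
    ring
  have hA' : ∑ j, ‖a j‖ ^ 2 = A := rfl
  -- expand `B(Λv - a, Λv - a)`
  have hexp : B ((Λ : ℂ) • v - a) ((Λ : ℂ) • v - a) =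
      (Λ : ℂ) * ((Λ : ℂ) * B v v) - (Λ : ℂ) * B v a - (Λ : ℂ) * B a v + B a a := by
    rw [hsubl, hsubr, hsubr, hsmull, hsmulr, hsmulr, hsmull]
    ring
  have h1 : 0 ≤ (B ((Λ : ℂ) • v - a) ((Λ : ℂ) • v - a)).re := hpsd _
  rw [hexp, hva, hav] at h1
  simp only [Complex.add_re, Complex.sub_re, Complex.mul_re, Complex.ofReal_re,
    Complex.ofReal_im, zero_mul, sub_zero] at h1
  have h2 : (B a a).re ≤ Λ * ∑ j, ‖a j‖ ^ 2 := hbd a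
  rw [hA'] at h2
  -- `0 ≤ Λ² Re B(v,v) - 2ΛA + Re B(a,a) ≤ Λ (Λ Re B(v,v) - A)`
  change A ≤ Λ * (B v v).re
  have h3 : Λ * A ≤ Λ * (Λ * (B v v).re) := by nlinarith
  exact le_of_mul_le_mul_left h3 hΛ

/-- **Schur bound.** For nonnegative symmetric entries with row sums `≤ Λ`,
`Re B(u, u) ≤ Λ ∑ⱼ |uⱼ|²`. [folklore] -/
theorem re_qf_le {N : ℕ} (M : Fin N → Fin N → ℝ) (hsymm : ∀ i j, M i j = M j i)
    (hM0 : ∀ i j, 0 ≤ M i j) {Λ : ℝ} (hrow : ∀ j, ∑ k, M j k ≤ Λ) (u : Fin N → ℂ) :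
    (∑ j, ∑ k, (M j k : ℂ) * u j * conj (u k)).re ≤ Λ * ∑ j, ‖u j‖ ^ 2 := by
  have hterm : ∀ j k, ‖(M j k : ℂ) * u j * conj (u k)‖ ≤
      M j k * ‖u j‖ ^ 2 / 2 + M j k * ‖u k‖ ^ 2 / 2 := by
    intro j k
    rw [norm_mul, norm_mul, Complex.norm_real, Real.norm_eq_abs, abs_of_nonneg (hM0 j k),
      Complex.norm_conj]
    have h2 := two_mul_le_add_sq ‖u j‖ ‖u k‖
    have := hM0 j k
    nlinarith
  calc (∑ j, ∑ k, (M j k : ℂ) * u j * conj (u k)).re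
      ≤ ‖∑ j, ∑ k, (M j k : ℂ) * u j * conj (u k)‖ := Complex.re_le_norm _
    _ ≤ ∑ j, ‖∑ k, (M j k : ℂ) * u j * conj (u k)‖ := norm_sum_le _ _
    _ ≤ ∑ j, ∑ k, ‖(M j k : ℂ) * u j * conj (u k)‖ :=
        Finset.sum_le_sum fun j _ => norm_sum_le _ _
    _ ≤ ∑ j, ∑ k, (M j k * ‖u j‖ ^ 2 / 2 + M j k * ‖u k‖ ^ 2 / 2) :=
        Finset.sum_le_sum fun j _ => Finset.sum_le_sum fun k _ => hterm j k
    _ = ∑ j, (‖u j‖ ^ 2 / 2) * ∑ k, M j k + ∑ k, (‖u k‖ ^ 2 / 2) * ∑ j, M k j := by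
        rw [Finset.sum_congr rfl fun j _ => Finset.sum_add_distrib, Finset.sum_add_distrib,
          Finset.sum_comm (f := fun j k => M j k * ‖u k‖ ^ 2 / 2)]
        congr 1
        · refine Finset.sum_congr rfl fun j _ => ?_
          rw [Finset.mul_sum]
          exact Finset.sum_congr rfl fun k _ => by ring
        · refine Finset.sum_congr rfl fun k _ => ?_
          rw [Finset.mul_sum]
          exact Finset.sum_congr rfl fun j _ => by rw [hsymm j k]; ring
    _ ≤ ∑ j, (‖u j‖ ^ 2 / 2) * Λ + ∑ k, (‖u k‖ ^ 2 / 2) * Λ := by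
        gcongr with j _ k _
        · exact hrow j
        · exact hrow k
    _ = Λ * ∑ j, ‖u j‖ ^ 2 := by rw [← Finset.sum_mul, ← Finset.sum_div]; ring

/-! ## The Gaussian matrix -/

/-- **`L²`-norm of a finite Gaussian sum with complex weights.**
`∫ |∑ⱼ uⱼ e^{-p|c - yⱼ|²}|² dc = ∑ⱼ∑ₖ uⱼ conj(uₖ) (π/2p)^{3/2} e^{-(p/2)|yⱼ-yₖ|²}` (complex form).
[folklore] -/
theorem integral_normSq_gaussSum_complex {N : ℕ} (u : Fin N → ℂ) {p : ℝ} (hp : 0 < p)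
    (y : Fin N → EuclideanSpace ℝ (Fin 3)) :
    (((∫ c : EuclideanSpace ℝ (Fin 3), ‖∑ j, u j * (Real.exp (-p * ‖c - y j‖ ^ 2) : ℂ)‖ ^ 2) : ℝ) : ℂ) =
      ∑ j, ∑ k, u j * conj (u k) * (((Real.pi / (p + p)) ^ ((3 : ℝ) / 2) *
        Real.exp (-(p * p / (p + p)) * ‖y j - y k‖ ^ 2) : ℝ) : ℂ) := by
  set g : Fin N → Fin N → EuclideanSpace ℝ (Fin 3) → ℂ := fun j k c => u j * conj (u k) *
    ((Real.exp (-p * ‖c - y j‖ ^ 2) * Real.exp (-p * ‖c - y k‖ ^ 2) : ℝ) : ℂ) with hg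
  have hgi : ∀ j k, Integrable (g j k) := fun j k =>
    ((integrable_gauss_mul_gauss hp hp (y j) (y k)).ofReal).const_mul _
  have hexp : ∀ c : EuclideanSpace ℝ (Fin 3), (((‖∑ j, u j * (Real.exp (-p * ‖c - y j‖ ^ 2) : ℂ)‖ ^ 2 : ℝ)) : ℂ) =
      ∑ j, ∑ k, g j k c := by
    intro c
    rw [Complex.ofReal_pow, ← Complex.mul_conj', map_sum, Finset.sum_mul_sum]
    refine Finset.sum_congr rfl fun j _ => Finset.sum_congr rfl fun k _ => ?_
    simp only [hg, map_mul, Complex.conj_ofReal]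
    push_cast
    ring
  rw [← integral_complex_ofReal]
  simp_rw [hexp]
  rw [integral_finsetSum _ fun j _ => integrable_finsetSum _ fun k _ => hgi j k]
  refine Finset.sum_congr rfl fun j _ => ?_
  rw [integral_finsetSum _ fun k _ => hgi j k]
  refine Finset.sum_congr rfl fun k _ => ?_
  rw [hg, integral_const_mul, integral_complex_ofReal, integral_gauss_mul_gauss hp hp]

/-- **The Gaussian matrix is positive semidefinite on `ℂᴺ`.**
`0 ≤ Re ∑ⱼ∑ₖ e^{-|yₖ - yⱼ|²/L²} uⱼ conj(uₖ)`. [folklore] -/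
theorem re_qf_gauss_nonneg {N : ℕ} (y : Fin N → EuclideanSpace ℝ (Fin 3)) {L : ℝ} (hL : 0 < L) (u : Fin N → ℂ) :
    0 ≤ (∑ j, ∑ k, (Real.exp (-(‖y k - y j‖ ^ 2) / L ^ 2) : ℂ) * u j * conj (u k)).re := by
  set p : ℝ := 2 / L ^ 2 with hp
  have hp0 : 0 < p := by positivity
  have hC : 0 < (Real.pi / (p + p)) ^ ((3 : ℝ) / 2) := by positivity
  have hpp : ∀ j k, -(p * p / (p + p)) * ‖y j - y k‖ ^ 2 = -(‖y k - y j‖ ^ 2) / L ^ 2 := by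
    intro j k
    rw [norm_sub_rev (y j) (y k), hp]
    field_simp
    ring
  have h := integral_normSq_gaussSum_complex u hp0 y
  simp_rw [hpp] at h
  have hq : (∑ j, ∑ k, (Real.exp (-(‖y k - y j‖ ^ 2) / L ^ 2) : ℂ) * u j * conj (u k)) *
      ((Real.pi / (p + p)) ^ ((3 : ℝ) / 2) : ℝ) =
      (((∫ c : EuclideanSpace ℝ (Fin 3), ‖∑ j, u j * (Real.exp (-p * ‖c - y j‖ ^ 2) : ℂ)‖ ^ 2) : ℝ) : ℂ) := by
    rw [h, Finset.sum_mul]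
    refine Finset.sum_congr rfl fun j _ => ?_
    rw [Finset.sum_mul]
    refine Finset.sum_congr rfl fun k _ => ?_
    push_cast
    ring
  have hre := congrArg Complex.re hq
  rw [Complex.re_mul_ofReal, Complex.ofReal_re] at hre
  have hI : 0 ≤ ∫ c : EuclideanSpace ℝ (Fin 3), ‖∑ j, u j * (Real.exp (-p * ‖c - y j‖ ^ 2) : ℂ)‖ ^ 2 :=
    integral_nonneg fun c => by positivity
  rw [← hre] at hI
  exact nonneg_of_mul_nonneg_left hI hC

/-- **Row sums of the Gaussian matrix.** For a `δ`-separated configuration and `L ≥ 1`,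
`∑ₖ e^{-|yₖ - yⱼ|²/L²} ≤ 2(2/δ+1)³ π√π L³`. [folklore] -/
theorem rowsum_gauss_le {N : ℕ} (y : Fin N → EuclideanSpace ℝ (Fin 3)) {δ : ℝ} (hδ : 0 < δ)
    (hsep : ∀ i j : Fin N, i ≠ j → δ ≤ dist (y i) (y j)) {L : ℝ} (hL : 1 ≤ L) (j : Fin N) :
    ∑ k, Real.exp (-(‖y k - y j‖ ^ 2) / L ^ 2) ≤
      2 * (2 / δ + 1) ^ 3 * (Real.pi * Real.sqrt Real.pi) * L ^ 3 := by
  have hL0 : 0 < L := by linarith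
  have hsqrtpi : 1 ≤ Real.sqrt Real.pi := by
    rw [← Real.sqrt_one]; exact Real.sqrt_le_sqrt (by linarith [Real.pi_gt_three])
  set s : ℝ := L * Real.sqrt Real.pi with hs
  have hs1 : 1 ≤ s := by rw [hs]; nlinarith
  have hs2 : s ^ 2 = L ^ 2 * Real.pi := by
    rw [hs, mul_pow, Real.sq_sqrt Real.pi_pos.le]
  have hs3 : s ^ 3 = Real.pi * Real.sqrt Real.pi * L ^ 3 := by
    have : s ^ 3 = s ^ 2 * s := by ring
    rw [this, hs2, hs]; ring
  have h := sum_exp_le y hδ hsep j hs1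
  have hterm : ∀ k, Real.exp (-(Real.pi / s ^ 2) * ‖y k - y j‖ ^ 2) =
      Real.exp (-(‖y k - y j‖ ^ 2) / L ^ 2) := by
    intro k
    rw [hs2]
    congr 1
    field_simp
  simp_rw [hterm] at h
  rw [hs3] at h
  linarith

/-! ## The operator inequality for Gaussian windows -/

/-- **`∑ᵢ |windowed structure factor at centre i|² ≤ Λ · Gaussian pair sum`.** For a
`δ`-separated configuration `y`, `L ≥ 1` and every `ξ`,
`∑ᵢ |∑ⱼ e^{-|yⱼ-yᵢ|²/L²} e^{2πi⟨ξ,yⱼ-yᵢ⟩}|² ≤ 2(2/δ+1)³π√π L³ · Re ∑ⱼ∑ₖ e^{-|yₖ-yⱼ|²/L²}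
e^{2πi⟨ξ,yⱼ⟩} conj e^{2πi⟨ξ,yₖ⟩}`. [folklore] -/
theorem sum_normSq_window_le {N : ℕ} (y : Fin N → EuclideanSpace ℝ (Fin 3)) {δ : ℝ} (hδ : 0 < δ)
    (hsep : ∀ i j : Fin N, i ≠ j → δ ≤ dist (y i) (y j)) {L : ℝ} (hL : 1 ≤ L) (ξ : EuclideanSpace ℝ (Fin 3)) :
    ∑ i, ‖∑ j, (Real.exp (-(‖y j - y i‖ ^ 2) / L ^ 2) : ℂ) *
        cexp (2 * Real.pi * I * (⟪ξ, y j - y i⟫ : ℂ))‖ ^ 2 ≤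
      (2 * (2 / δ + 1) ^ 3 * (Real.pi * Real.sqrt Real.pi) * L ^ 3) *
        (∑ j, ∑ k, (Real.exp (-(‖y k - y j‖ ^ 2) / L ^ 2) : ℂ) *
          cexp (2 * Real.pi * I * (⟪ξ, y j⟫ : ℂ)) *
          conj (cexp (2 * Real.pi * I * (⟪ξ, y k⟫ : ℂ)))).re := by
  have hL0 : 0 < L := by linarith
  set M : Fin N → Fin N → ℝ := fun i j => Real.exp (-(‖y j - y i‖ ^ 2) / L ^ 2) with hM
  set Λ : ℝ := 2 * (2 / δ + 1) ^ 3 * (Real.pi * Real.sqrt Real.pi) * L ^ 3 with hΛ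
  have hΛ0 : 0 < Λ := by positivity
  have hsymm : ∀ i j, M i j = M j i := fun i j => by simp only [hM, norm_sub_rev]
  set v : Fin N → ℂ := fun j => cexp (2 * Real.pi * I * (⟪ξ, y j⟫ : ℂ)) with hv
  have hv1 : ∀ j, ‖v j‖ = 1 := fun j =>
    Literature.NumberTheory.UniformDistribution.norm_cexp_two_pi_mul_ofReal _
  -- recentring the phases does not change the modulus
  have hLHS : ∀ i, ‖∑ j, (Real.exp (-(‖y j - y i‖ ^ 2) / L ^ 2) : ℂ) *
      cexp (2 * Real.pi * I * (⟪ξ, y j - y i⟫ : ℂ))‖ = ‖∑ j, (M i j : ℂ) * v j‖ := by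
    intro i
    have : ∑ j, (Real.exp (-(‖y j - y i‖ ^ 2) / L ^ 2) : ℂ) *
        cexp (2 * Real.pi * I * (⟪ξ, y j - y i⟫ : ℂ)) = (∑ j, (M i j : ℂ) * v j) * conj (v i) := by
      rw [Finset.sum_mul]
      refine Finset.sum_congr rfl fun j _ => ?_
      have hph := phase_sub ξ (y j) (y i)
      rw [show (↑(2 * Real.pi * ⟪ξ, y j - y i⟫) * I : ℂ) =
        2 * Real.pi * I * (⟪ξ, y j - y i⟫ : ℂ) by push_cast; ring] at hph
      rw [hph, hM, hv]
      ring
    rw [this, norm_mul, Complex.norm_conj, hv1 i, mul_one]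
  simp_rw [hLHS]
  have key := sum_normSq_mulVec_le M hsymm (fun u => re_qf_gauss_nonneg y hL0 u) hΛ0
    (fun u => re_qf_le M hsymm (fun i j => (Real.exp_pos _).le)
      (fun j => rowsum_gauss_le y hδ hsep hL j) u) v
  exact key

/-! ## The uniform gap of an admissible test function -/

/-- **Uniform gap.** If `tsupport h` is compact and avoids `0` and every sphere through a vector
`k` of the dual of the lattice of `P`, then `|‖ξ‖ - ‖k‖| ≥ d > 0` for all `ξ ∈ tsupport h` and all
dual `k` (in particular `‖ξ‖ ≥ d`, `k = 0`). [folklore] -/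
theorem exists_gap (P : PeriodicConfiguration 3) {h : EuclideanSpace ℝ (Fin 3) → ℝ} (hhs : HasCompactSupport h)
    (hadm : ∀ ξ ∈ tsupport h, ξ ≠ 0 ∧ ∀ k : EuclideanSpace ℝ (Fin 3), (∀ g ∈ P.lattice, ∃ n : ℤ, ⟪k, g⟫ = (n : ℝ)) → ‖ξ‖ ≠ ‖k‖) :
    ∃ d : ℝ, 0 < d ∧ ∀ ξ ∈ tsupport h, ∀ k : EuclideanSpace ℝ (Fin 3), (∀ g ∈ P.lattice, ∃ n : ℤ, ⟪k, g⟫ = (n : ℝ)) →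
      d ≤ |‖ξ‖ - ‖k‖| := by
  obtain ⟨R₀, hR₀⟩ := hhs.isCompact.isBounded.subset_closedBall (0 : EuclideanSpace ℝ (Fin 3))
  set R : ℝ := max R₀ 0 with hRdef
  have hR : tsupport h ⊆ closedBall (0 : EuclideanSpace ℝ (Fin 3)) R :=
    hR₀.trans (closedBall_subset_closedBall (le_max_left _ _))
  have hR0 : 0 ≤ R := le_max_right _ _
  obtain ⟨r, hr, hdual⟩ := exists_pos_le_norm_of_dual P
  -- the dual vectors of norm `≤ R + 1` are finitely many
  set D : Set (EuclideanSpace ℝ (Fin 3)) := {k | (∀ g ∈ P.lattice, ∃ n : ℤ, ⟪k, g⟫ = (n : ℝ)) ∧ ‖k‖ ≤ R + 1} with hD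
  have hDfin : D.Finite := by
    refine finite_of_forall_le_dist_of_subset_closedBall hr (fun p hp q hq hpq => ?_)
      (c := (0 : EuclideanSpace ℝ (Fin 3))) (R := R + 1) (fun k hk => by simpa using hk.2)
    rw [dist_eq_norm]
    refine hdual (p - q) (fun g hg => ?_) (sub_ne_zero.2 hpq)
    obtain ⟨m, hm⟩ := hp.1 g hg
    obtain ⟨n, hn⟩ := hq.1 g hg
    exact ⟨m - n, by rw [inner_sub_left, hm, hn]; push_cast; ring⟩
  have h0D : (0 : EuclideanSpace ℝ (Fin 3)) ∈ D := ⟨fun g _ => ⟨0, by simp⟩, by simp only [norm_zero]; linarith⟩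
  set NR : Set ℝ := (fun k : EuclideanSpace ℝ (Fin 3) => ‖k‖) '' D with hNR
  have hNRcl : IsClosed NR := (hDfin.image _).isClosed
  have hNRne : NR.Nonempty := ⟨‖(0 : EuclideanSpace ℝ (Fin 3))‖, mem_image_of_mem _ h0D⟩
  -- the gap function `ξ ↦ dist(‖ξ‖, NR)` is continuous and positive on the support
  set φ : EuclideanSpace ℝ (Fin 3) → ℝ := fun ξ => infDist ‖ξ‖ NR with hφ
  have hφc : Continuous φ := (continuous_infDist_pt NR).comp continuous_norm
  have hφpos : ∀ ξ ∈ tsupport h, 0 < φ ξ := by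
    intro ξ hξ
    apply (hNRcl.notMem_iff_infDist_pos hNRne).1
    rintro ⟨k, hk, hkξ⟩
    exact (hadm ξ hξ).2 k hk.1 hkξ.symm
  obtain ⟨m, hm, hmle⟩ :=
    exists_pos_forall_le_of_isCompact hhs.isCompact hφc.continuousOn hφpos
  refine ⟨min m 1, lt_min hm one_pos, fun ξ hξ k hk => ?_⟩
  by_cases hkR : ‖k‖ ≤ R + 1
  · have hkD : k ∈ D := ⟨hk, hkR⟩
    have h1 : φ ξ ≤ dist ‖ξ‖ ‖k‖ := infDist_le_dist_of_mem (mem_image_of_mem _ hkD)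
    rw [Real.dist_eq] at h1
    exact (min_le_left _ _).trans ((hmle ξ hξ).trans h1)
  · have hξR : ‖ξ‖ ≤ R := by simpa using hR hξ
    rw [not_le] at hkR
    have : 1 ≤ |‖ξ‖ - ‖k‖| := by
      rw [abs_sub_comm, abs_of_pos (by linarith)]; linarith
    exact (min_le_right _ _).trans this

/-! ## A cutoff near the support -/

/-- **Cutoff on a neighbourhood of a compact set.** For `K` compact and `d > 0` there is a
continuous compactly supported `f : ℝ³ → [0,1]` with `f = 1` at every point within `d/2` of `K`
and `tsupport f` within `3d/4` of `K`. [folklore] -/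
theorem exists_thickCutoff {K : Set (EuclideanSpace ℝ (Fin 3))} (hK : IsCompact K) {d : ℝ} (hd : 0 < d) :
    ∃ f : EuclideanSpace ℝ (Fin 3) → ℝ, Continuous f ∧ HasCompactSupport f ∧ (∀ ξ, 0 ≤ f ξ ∧ f ξ ≤ 1) ∧
      (∀ ξ, (∃ t ∈ K, dist ξ t ≤ d / 2) → f ξ = 1) ∧
      (∀ ξ ∈ tsupport f, ∃ t ∈ K, dist ξ t ≤ 3 * d / 4) := by
  obtain ⟨f, hf1, hf0, hfs, hf01⟩ := exists_continuous_one_zero_of_isCompact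
    (hK.cthickening (r := d / 2)) (isOpen_thickening (δ := 3 * d / 4) (E := K)).isClosed_compl
    (disjoint_compl_right_iff_subset.2 (cthickening_subset_thickening' (by linarith) (by linarith) K))
  refine ⟨f, f.continuous, hfs, fun ξ => ⟨(hf01 ξ).1, (hf01 ξ).2⟩, fun ξ hξ => ?_, fun ξ hξ => ?_⟩
  · obtain ⟨t, ht, hξt⟩ := hξ
    have := hf1 (mem_cthickening_of_dist_le ξ t (d / 2) K ht hξt)
    simpa using this
  · have hsupp : Function.support f ⊆ thickening (3 * d / 4) K := by
      intro ζ hζ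
      by_contra hnot
      exact hζ (by simpa using hf0 hnot)
    have hts : tsupport (f : EuclideanSpace ℝ (Fin 3) → ℝ) ⊆ cthickening (3 * d / 4) K :=
      (closure_mono hsupp).trans (closure_thickening_subset_cthickening _ _)
    have hmem := hts hξ
    rw [hK.cthickening_eq_biUnion_closedBall (by positivity), mem_iUnion₂] at hmem
    obtain ⟨t, ht, hξt⟩ := hmem
    exact ⟨t, ht, mem_closedBall.1 hξt⟩

end HcpRigidityQuietCentres

/-- **Registered helper stub of `stub_quietCentres` (Aux file 1): the operator inequality for
Gaussian windows.** For a `δ`-separated configuration `y` in `ℝ³`, `L ≥ 1` and every `ξ`,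
`∑ᵢ |∑ⱼ e^{-|yⱼ-yᵢ|²/L²} e^{2πi⟨ξ,yⱼ-yᵢ⟩}|² ≤ 2(2/δ+1)³π√π L³ · Re ∑ⱼ∑ₖ e^{-|yₖ-yⱼ|²/L²}
e^{2πi⟨ξ,yⱼ⟩} conj e^{2πi⟨ξ,yₖ⟩}`. [folklore] -/
theorem stub_quietCentresOperatorIneq : ∀ (N : ℕ) (y : Fin N → EuclideanSpace ℝ (Fin 3)) (δ : ℝ), 0 < δ → (∀ i j : Fin N, i ≠ j → δ ≤ dist (y i) (y j)) → ∀ L : ℝ, 1 ≤ L → ∀ ξ : EuclideanSpace ℝ (Fin 3), ∑ i : Fin N, ‖∑ j : Fin N, (Real.exp (-(‖y j - y i‖ ^ 2) / L ^ 2) : ℂ) * Complex.exp (2 * Real.pi * Complex.I * (inner ℝ ξ (y j - y i) : ℂ))‖ ^ 2 ≤ (2 * (2 / δ + 1) ^ 3 * (Real.pi * Real.sqrt Real.pi) * L ^ 3) * (∑ j : Fin N, ∑ k : Fin N, (Real.exp (-(‖y k - y j‖ ^ 2) / L ^ 2) : ℂ) * Complex.exp (2 * Real.pi * Complex.I * (inner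 ℝ ξ (y j) : ℂ)) * (starRingEnd ℂ) (Complex.exp (2 * Real.pi * Complex.I * (inner ℝ ξ (y k) : ℂ)))).re :=
  fun _ y _ hδ hsep _ hL ξ => HcpRigidityQuietCentres.sum_normSq_window_le y hδ hsep hL ξ

end Summit.AtomisticToContinuum.Crystallization.Theorems

end
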